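import Mathlib
import HarnessLib
import Summits.RiemannHypothesis.RiemannHypothesis.Theorems.IntegerScrewRungCertTableN

/-!
# Route `IntegerScrew` — kernel certificate checker: ASSEMBLY for the streamed table (`uTableNA`)

The soundness theorems of the wide rung checker restated with the entry table's MEMBERSHIP as the hypothesis, so that any
table function with a membership lemma plugs in (here `uTableNA` of `IntegerScrewRungCertTableN`):
★ `posDef_of_rungW_mem` (light checks + all indexed row tests + `u(a,b) ∈ utab[a][b]` ⇒ `screwMatrix N ≻ 0`),
`posDef_of_rungNA` / `screwPivot_pos_of_rungNA`, ★ `quadForm_ge_of_rungW_mem` (the bound kept: `(lamZ/2^49)‖v‖² ≤ vᵀS_{N+1}v`),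
`mem_ug_uTableNA_of_light`.  The proofs are those of `posDef_of_rungW` / `RungCert.quadForm_ge_of_rungW` (`…WideCheck`,
`IntegerScrewRung128`) with the table identity replaced by membership.  Nothing here bears on the truth of RH.
References: S. M. Rump, Acta Numerica 19 (2010) §10.8 [folklore]; M. Suzuki, J. Lond. Math. Soc. (2) 108 (2023) [Suzuki2023].
-/

set_option linter.dupNamespace false
set_option autoImplicit false

namespace Summit.RiemannHypothesis.RiemannHypothesis.Theorems.IntegerScrew.RungCert

open Literature.NumberTheory.LFunctions Literature.Analysis.ValidatedNumerics Finset
open Literature.Analysis.ValidatedNumerics.Numerics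
open scoped BigOperators

/-! ## Table-agnostic assembly (the proof of `posDef_of_rungW` with the table's membership as the hypothesis) -/

/-- **Soundness of the wide rung checker for ANY enclosing table**: the light part, all row tests of the integer
domination check, and `u(a,b) ∈ utab[a][b]` for `0 < b < a ≤ N + 1` imply `S_{N+1} = screwMatrix N ≻ 0`. [folklore] -/
theorem posDef_of_rungW_mem {N : ℕ} {lam : List (ℕ × ℕ × ℕ)} {sqs logs : List FI} {utab : List (List FI)}
    {Lz : List (List ℤ)} {lamZ : ℤ} (h : rungLightW N lam sqs logs Lz lamZ = true)
    (hz : ∀ i < N, zrowW N utab Lz lamZ i = true)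
    (hut : ∀ a b : ℕ, 0 < b → b < a → a ≤ N + 1 → FI.mem (uR a b) (ug utab a b)) : (screwMatrix N).PosDef := by
  rcases Nat.eq_zero_or_pos N with rfl | hNpos
  · exact screwMatrix_zero_posDef
  unfold rungLightW at h
  simp only [Bool.and_eq_true, decide_eq_true_eq] at h
  obtain ⟨⟨⟨⟨⟨_, _⟩, _⟩, _⟩, hlz⟩, hpos⟩ := h
  have hcheck' := zcheck_of_zrowW hlz hz
  have hform : ∀ v : Fin N → ℝ, ((lamZ : ℤ) : ℝ) / (2 * SC) * dotProduct v v ≤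
      dotProduct v ((tMat ((cLoF : ℚ) : ℝ) N).mulVec v) := by
    intro v
    rw [← quadForm_pad, ← sqSum_pad]
    refine mul_sqSum_le_quadForm_of_zcheck hcheck' (fun i hi j hj => ?_) _
    have hi' := mem_range.1 hi; have hj' := mem_range.1 hj
    unfold czOf rzOf
    rw [padM_of_lt _ hi' hj', pg_tzTab utab hi' hj']
    exact abs_sub_le_of_mem (mem_tEnclF hut hi' hj')
  have hlam' : (0 : ℝ) < ((lamZ : ℤ) : ℝ) / (2 * SC) := by
    have : (0 : ℝ) < ((lamZ : ℤ) : ℝ) := by exact_mod_cast hpos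
    exact div_pos this (mul_pos two_pos SC_pos)
  have hpd : (tMat ((cLoF : ℚ) : ℝ) N).PosDef := by
    refine Matrix.PosDef.of_dotProduct_mulVec_pos (tMat_isHermitian _ _) fun v hv => ?_
    have hvv : 0 < dotProduct v v := by
      have := Matrix.dotProduct_star_self_pos_iff.mpr hv
      simpa using this
    have := hform v
    rw [star_trivial]
    exact lt_of_lt_of_le (mul_pos hlam' hvv) this
  rw [screwMatrix_eq_tMat, tMat_split lerchC ((cLoF : ℚ) : ℝ)]
  exact hpd.add_posSemidef ((one_add_vecMulVec_posSemidef N).smul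
    (div_nonneg (sub_nonneg.2 cLoF_le_lerchC) (by norm_num)))

/-- **Soundness with the formula-count table** `uTableNA` (the form the heavy files decide on). [folklore] -/
theorem posDef_of_rungNA {N : ℕ} {lam : List (ℕ × ℕ × ℕ)} {sqs logs : List FI} {Lz : List (List ℤ)} {lamZ : ℤ}
    (h : rungLightW N lam sqs logs Lz lamZ = true) {A : FI} (hA : slopeEncl logs = some A) {TB : ℕ}
    (hz : ∀ i < N, zrowW N (uTableNA lam sqs logs A N TB) Lz lamZ i = true) : (screwMatrix N).PosDef := by
  rcases Nat.eq_zero_or_pos N with rfl | hNpos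
  · exact screwMatrix_zero_posDef
  refine posDef_of_rungW_mem h hz fun a b hb hba ha => ?_
  unfold rungLightW at h
  simp only [Bool.and_eq_true, decide_eq_true_eq] at h
  obtain ⟨⟨⟨⟨⟨hlam, hsq⟩, hlogs⟩, hok⟩, _⟩, _⟩ := h
  have hL := logsOK_of_eq hlogs hok
  have hAv : FI.mem slopeA A := mem_slopeEncl hL (by omega) hA
  exact mem_ug_uTableNA (fun n hn => lamTabOK_sound hlam (n := n) hn) (fun n hn => mem_of_sqrtTabOK hsq (n := n) hn)
    hL le_rfl hAv TB hb hba ha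

/-- Corollary: pivots `d_M > 0` for `2 ≤ M ≤ N + 1`. [folklore] -/
theorem screwPivot_pos_of_rungNA {N : ℕ} {lam : List (ℕ × ℕ × ℕ)} {sqs logs : List FI} {Lz : List (List ℤ)}
    {lamZ : ℤ} (h : rungLightW N lam sqs logs Lz lamZ = true) {A : FI} (hA : slopeEncl logs = some A) {TB : ℕ}
    (hz : ∀ i < N, zrowW N (uTableNA lam sqs logs A N TB) Lz lamZ i = true) {M : ℕ} (hM : 2 ≤ M)
    (hMN : M ≤ N + 1) : 0 < screwPivot M :=
  screwPivot_pos_of_posDef_le (posDef_of_rungNA h hA hz) M hM hMN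

/-- **Quantitative form, table-agnostic**: under the light checks, the row tests and the table's membership,
`(lamZ/2^49)·‖v‖² ≤ vᵀ S_{N+1} v` for every real `v` (the proof of `RungCert.quadForm_ge_of_rungW` with `hut` as the
hypothesis). [folklore] -/
theorem quadForm_ge_of_rungW_mem {N : ℕ} {lam : List (ℕ × ℕ × ℕ)} {sqs logs : List FI} {utab : List (List FI)}
    {Lz : List (List ℤ)} {lamZ : ℤ} (h : rungLightW N lam sqs logs Lz lamZ = true)
    (hz : ∀ i < N, zrowW N utab Lz lamZ i = true)
    (hut : ∀ a b : ℕ, 0 < b → b < a → a ≤ N + 1 → FI.mem (uR a b) (ug utab a b)) (v : Fin N → ℝ) :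
    ((lamZ : ℤ) : ℝ) / (2 * SC) * (v ⬝ᵥ v) ≤ v ⬝ᵥ ((screwMatrix N).mulVec v) := by
  rcases Nat.eq_zero_or_pos N with rfl | hNpos
  · simp [dotProduct]
  unfold rungLightW at h
  simp only [Bool.and_eq_true, decide_eq_true_eq] at h
  obtain ⟨⟨⟨⟨⟨_, _⟩, _⟩, _⟩, hlz⟩, _⟩ := h
  have hcheck' := zcheck_of_zrowW hlz hz
  have hform : ((lamZ : ℤ) : ℝ) / (2 * SC) * (v ⬝ᵥ v) ≤ v ⬝ᵥ ((tMat ((cLoF : ℚ) : ℝ) N).mulVec v) := by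
    rw [← quadForm_pad, ← sqSum_pad]
    refine mul_sqSum_le_quadForm_of_zcheck hcheck' (fun i hi j hj => ?_) _
    have hi' := Finset.mem_range.1 hi; have hj' := Finset.mem_range.1 hj
    unfold czOf rzOf
    rw [padM_of_lt _ hi' hj', pg_tzTab utab hi' hj']
    exact abs_sub_le_of_mem (mem_tEnclF hut hi' hj')
  have hpsd := (one_add_vecMulVec_posSemidef N).smul
    (div_nonneg (sub_nonneg.2 cLoF_le_lerchC) (by norm_num : (0 : ℝ) ≤ 4))
  have h2 := hpsd.dotProduct_mulVec_nonneg v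
  rw [star_trivial] at h2
  rw [screwMatrix_eq_tMat, tMat_split lerchC ((cLoF : ℚ) : ℝ), Matrix.add_mulVec, dotProduct_add]
  linarith

/-- The membership of `uTableNA` from the light checks (for `posDef_of_rungW_mem` / `quadForm_ge_of_rungW_mem`). [folklore] -/
theorem mem_ug_uTableNA_of_light {N : ℕ} {lam : List (ℕ × ℕ × ℕ)} {sqs logs : List FI} {Lz : List (List ℤ)} {lamZ : ℤ}
    (h : rungLightW N lam sqs logs Lz lamZ = true) {A : FI} (hA : slopeEncl logs = some A) (TB : ℕ) (hN : 0 < N) :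
    ∀ a b : ℕ, 0 < b → b < a → a ≤ N + 1 → FI.mem (uR a b) (ug (uTableNA lam sqs logs A N TB) a b) := by
  intro a b hb hba ha
  unfold rungLightW at h
  simp only [Bool.and_eq_true, decide_eq_true_eq] at h
  obtain ⟨⟨⟨⟨⟨hlam, hsq⟩, hlogs⟩, hok⟩, _⟩, _⟩ := h
  have hL := logsOK_of_eq hlogs hok
  have hAv : FI.mem slopeA A := mem_slopeEncl hL (by omega) hA
  exact mem_ug_uTableNA (fun n hn => lamTabOK_sound hlam (n := n) hn) (fun n hn => mem_of_sqrtTabOK hsq (n := n) hn)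
    hL le_rfl hAv TB hb hba ha

end Summit.RiemannHypothesis.RiemannHypothesis.Theorems.IntegerScrew.RungCert
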